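import Mathlib
import Summits.KontsevichZagierPeriods.Zeta5Search.CatalanTwoAdicRayGrowth
import Summits.KontsevichZagierPeriods.Zeta5Search.CatalanRayQBound
import Literature.NumberTheory.Transcendental.ZetaLinearFormsCriterion
import HarnessLib

/-!
# The 2-adic ray chain, III: the archimedean growth input is a THEOREM — two named hypotheses remain

HONEST FRAMING: systematic search; no irrationality claim unless certified.  Sequel to `CatalanTwoAdicRay.lean` /
`CatalanTwoAdicRayGrowth.lean` (pub-zeta5 fam-catalan gen 2, TWOADIC.md §11–§12).  This file removes hypothesis (iii)
(`RayGrowth`) of the ray chain for EVERY ray: with `Λ_n = d*_{(j+1)n} d*_{jn} 2^{2Wn}` (`rayMult`, `W = 2j+1`) and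
`Q_n = rayQ j n`,

* `rayMult_eventually_le_exp` — `Λ_n ≤ e^{(W(1 + 2 log 2) + ε) n}` for large `n` (prime number theorem in the tree's form
  `eventually_lcmUpto_mul_le_exp`, and `d*_N ≤ lcm(1..N)`);
* `ray_growth` — `|Λ_n Q_n|, Λ_n ≤ e^{(h_j + ε) n}` for large `n`, `h_j = rayRate j = b_j + W(1 + 2 log 2)`,
  `b_j = (j+1) log(j+1) − j log j` (from the elementary bound `abs_catalanQ_ray_le_exp` of `CatalanRayQBound.lean` —
  the same rate `b_j` the zeta5-calc lane certified by two exact routes for `j = 5, 6, 8, 10, 12`);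
* `ray_measure_two_nodes` — GIVEN ONLY the transfer law `TwoAdicTransfer` (K5a, paper-proved) and `RayIntegrality j`
  (CATK6: fam-denom, paper-proved for `j ≥ 4`; kernel for their closed form modulo the identification `P_n = rayPClosed j n`),
  every `τ ∈ (h_j, 4W log 2)` and `τ' > 4W log 2` give `‖ξ − u/v‖₂ ≥ C·max(|u|,v)^{−κ}` for all rationals, `κ < τ'/(τ − h_j) + 1`;
* `ray_measure_intrinsic_two_inputs` / `xi_not_ratCast_intrinsic` — the INTRINSIC chain (`ray_measure_intrinsic` of
  `CatalanTwoAdicRay.lean`) with the growth of `Q` discharged: for ANY rational sequence `P n` with the 2-adic identity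
  `J2 = P n + ξQ_n`, `Λ_n P n ∈ ℤ` and `|Λ_n P n| ≤ e^{(h_j+ε)n}` eventually, the measure (every `j ≥ 1`) and `ξ ∉ ℚ`
  (`j ≥ 3`) follow — no `Jsym`, no `G`, no transfer law: the shape in which the line becomes UNCONDITIONAL once
  fam-denom's closed form `rayPClosed` is shown to satisfy the 2-adic identity (finite algebra in `ℚ₂`) and the size bound;
* `rayRate_lt` — the margin `h_j < 4W log 2` holds for every `j ≥ 3` (elementary: `log x ≤ x − 1` and `log 2 > 0.6931`), whence
  `xi_not_ratCast_two_nodes`: for `j ≥ 3`, transfer ∧ integrality ⇒ `ξ ∉ ℚ` (a conditional 2-adic re-derivation of the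
  KNOWN irrationality of `ζ₂(2)`, Calegari 2005; numerically `ξ = ζ₂(2)` to 2116 bits, identification not formalised).
Numbers (TWOADIC.md §11.3, unchanged): ray 8 gives `μ₂ ≤ 4·17 log 2/(47.13 − 43.71) + o(1) ≈ 13.76`; no ray reaches the
7.1774 extractable from Calegari 2005 / Beukers 2008 (F16).
-/

namespace Summit.KontsevichZagierPeriods.Zeta5Search.CatalanTwoAdicSeries

open Real Finset Filter
open Summit.KontsevichZagierPeriods.Zeta5Search.CatalanQSum (catalanQ)

/-! ### The multiplier `Λ_n` -/

/-- `d*_N ≤ lcm(1, …, N)` (the odd part of the lcm is a sub-product of `∏_{p ≤ N} p^{⌊log_p N⌋}`). -/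
theorem dstarOdd_le_lcmUpto (N : ℕ) : dstarOdd N ≤ Nat.lcmUpto N := by
  rw [dstarOdd, Nat.lcmUpto_eq_prod_pow_log]
  apply Finset.prod_le_prod_of_subset_of_one_le'
  · intro p hp
    simp only [Finset.mem_filter, Finset.mem_range] at hp
    exact Nat.mem_primesLE.mpr ⟨by omega, hp.2.1⟩
  · intro p hp _
    exact Nat.one_le_pow _ _ (Nat.prime_of_mem_primesLE hp).pos

/-- `Λ_n ≤ e^{(W(1 + 2 log 2) + ε) n}` for all large `n`, `W = 2j+1` (prime number theorem). -/
theorem rayMult_eventually_le_exp (j : ℕ) {ε : ℝ} (hε : 0 < ε) :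
    ∀ᶠ n : ℕ in atTop, ((rayMult j n : ℚ) : ℝ) ≤ exp (((2 * j + 1) * (1 + 2 * log 2) + ε) * n) := by
  have h1 := Literature.NumberTheory.Transcendental.eventually_lcmUpto_mul_le_exp (j + 1) (half_pos hε)
  have h2 := Literature.NumberTheory.Transcendental.eventually_lcmUpto_mul_le_exp j (half_pos hε)
  filter_upwards [h1, h2] with n hn1 hn2
  have hA : ((dstarOdd ((j + 1) * n) : ℕ) : ℝ) ≤ exp ((((j + 1 : ℕ) : ℝ) + ε / 2) * n) :=
    le_trans (by exact_mod_cast dstarOdd_le_lcmUpto _) hn1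
  have hB : ((dstarOdd (j * n) : ℕ) : ℝ) ≤ exp ((((j : ℕ) : ℝ) + ε / 2) * n) :=
    le_trans (by exact_mod_cast dstarOdd_le_lcmUpto _) hn2
  have hC : (2 : ℝ) ^ (2 * (2 * j + 1) * n) = exp (((2 * (2 * j + 1) * n : ℕ) : ℝ) * log 2) := by
    rw [← Real.exp_log (by positivity : (0 : ℝ) < 2 ^ (2 * (2 * j + 1) * n)), Real.log_pow]
  have hstep : ((rayMult j n : ℚ) : ℝ)
      = ((dstarOdd ((j + 1) * n) : ℕ) : ℝ) * ((dstarOdd (j * n) : ℕ) : ℝ) * (2 : ℝ) ^ (2 * (2 * j + 1) * n) := by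
    unfold rayMult; push_cast; ring
  rw [hstep, hC]
  calc ((dstarOdd ((j + 1) * n) : ℕ) : ℝ) * ((dstarOdd (j * n) : ℕ) : ℝ) * exp (((2 * (2 * j + 1) * n : ℕ) : ℝ) * log 2)
      ≤ exp ((((j + 1 : ℕ) : ℝ) + ε / 2) * n) * exp ((((j : ℕ) : ℝ) + ε / 2) * n)
          * exp (((2 * (2 * j + 1) * n : ℕ) : ℝ) * log 2) := by
        gcongr
    _ = exp (((2 * j + 1) * (1 + 2 * log 2) + ε) * n) := by
        rw [← Real.exp_add, ← Real.exp_add]; push_cast; ring_nf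

/-- A linear factor is absorbed by an exponential: `K (n + 1) ≤ e^{ε n}` for all large `n`. -/
theorem eventually_linear_le_exp {K ε : ℝ} (hK : 0 ≤ K) (hε : 0 < ε) :
    ∀ᶠ n : ℕ in atTop, K * ((n : ℝ) + 1) ≤ exp (ε * n) := by
  obtain ⟨N, hN⟩ := exists_nat_ge (8 * K / ε ^ 2 + 1)
  filter_upwards [eventually_ge_atTop N] with n hn
  have hn' : (8 * K / ε ^ 2 + 1 : ℝ) ≤ n := hN.trans (by exact_mod_cast hn)
  have hK' : 0 ≤ 8 * K / ε ^ 2 := by positivity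
  have hn1 : (1 : ℝ) ≤ n := by linarith
  have hKn : 8 * K ≤ ε ^ 2 * n := by
    have h := (div_le_iff₀ (by positivity : (0 : ℝ) < ε ^ 2)).mp (by linarith : 8 * K / ε ^ 2 ≤ n)
    linarith
  have h1 : 1 + ε * n / 2 ≤ exp (ε * n / 2) := by linarith [Real.add_one_le_exp (ε * n / 2)]
  have h0 : 0 ≤ 1 + ε * n / 2 := by positivity
  have h2 : exp (ε * n) = exp (ε * n / 2) * exp (ε * n / 2) := by rw [← Real.exp_add]; ring_nf
  rw [h2]
  nlinarith [mul_le_mul h1 h1 h0 (h0.trans h1)]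

/-! ### The proved rate -/

/-- The PROVED archimedean rate of the `j`-th ray: `h_j = b_j + W (1 + 2 log 2)`, `W = 2j+1`
(`h_8 = 9 log 9 − 8 log 8 + 17(1 + 2 log 2) ≈ 43.71`). -/
noncomputable def rayRate (j : ℕ) : ℝ := bRate j + (2 * j + 1) * (1 + 2 * log 2)

/-- `b_j ≥ 0`. -/
theorem bRate_nonneg (j : ℕ) : 0 ≤ bRate j := by
  unfold bRate
  rcases Nat.eq_zero_or_pos j with rfl | hj
  · simp
  have hj0 : (0 : ℝ) < j := by exact_mod_cast hj
  have hlog : log j ≤ log ((j : ℝ) + 1) := Real.log_le_log hj0 (by linarith)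
  have hl0 : 0 ≤ log (j : ℝ) := Real.log_nonneg (by exact_mod_cast hj)
  nlinarith

/-- `h_j ≥ 0`. -/
theorem rayRate_nonneg (j : ℕ) : 0 ≤ rayRate j := by
  unfold rayRate
  have := bRate_nonneg j
  have : 0 < log (2 : ℝ) := log_pos one_lt_two
  positivity

/-- **Unconditional growth of the explicit objects of the ray chain**: for every `ε > 0` and all large `n`,
`|Λ_n Q_n| ≤ e^{(h_j + ε) n}` and `Λ_n ≤ e^{(h_j + ε) n}`. -/
theorem ray_growth (j : ℕ) (hj : 1 ≤ j) {ε : ℝ} (hε : 0 < ε) :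
    ∃ n₀ : ℕ, (∀ n : ℕ, n₀ ≤ n → |((rayMult j n : ℚ) : ℝ) * ((rayQ j n : ℚ) : ℝ)| ≤ exp ((rayRate j + ε) * n))
      ∧ (∀ n : ℕ, n₀ ≤ n → ((rayMult j n : ℚ) : ℝ) ≤ exp ((rayRate j + ε) * n)) := by
  have hΛ := rayMult_eventually_le_exp j (half_pos hε)
  have hP := eventually_linear_le_exp (K := 8 * j) (by positivity) (half_pos hε)
  obtain ⟨n₀, hn₀⟩ := eventually_atTop.mp (hΛ.and hP)
  have hb := bRate_nonneg j
  refine ⟨n₀, fun n hn => ?_, fun n hn => ?_⟩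
  · obtain ⟨h1, h2⟩ := hn₀ n hn
    have hΛ0 : (0 : ℝ) ≤ ((rayMult j n : ℚ) : ℝ) := by exact_mod_cast rayMult_nonneg j n
    have hQ := abs_catalanQ_ray_le_exp j n hj
    have hj1 : (1 : ℝ) ≤ j := by exact_mod_cast hj
    have hpoly : (8 : ℝ) * ((j * n : ℕ) + 1) ≤ 8 * j * ((n : ℝ) + 1) := by push_cast; nlinarith
    rw [abs_mul, abs_of_nonneg hΛ0]
    unfold rayQ
    calc ((rayMult j n : ℚ) : ℝ) * |((catalanQ n (j * n) n ((j + 1) * n) n : ℚ) : ℝ)|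
        ≤ exp (((2 * j + 1) * (1 + 2 * log 2) + ε / 2) * n) * (8 * ((j * n : ℕ) + 1) * exp (bRate j * n)) :=
          mul_le_mul h1 hQ (abs_nonneg _) (by positivity)
      _ ≤ exp (((2 * j + 1) * (1 + 2 * log 2) + ε / 2) * n) * (exp (ε / 2 * n) * exp (bRate j * n)) := by
          gcongr; exact hpoly.trans h2
      _ = exp ((rayRate j + ε) * n) := by
          rw [← Real.exp_add, ← Real.exp_add, rayRate]; ring_nf
  · obtain ⟨h1, -⟩ := hn₀ n hn
    refine h1.trans (Real.exp_le_exp.mpr ?_)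
    rw [rayRate]
    have hn0 : (0 : ℝ) ≤ n := by positivity
    nlinarith

/-! ### The ray chain with two named hypotheses -/

/-- **THE RAY MEASURE, growth discharged.**  GIVEN the transfer law (K5a) and `P`-integrality on the `j`-th ray (CATK6),
every `τ ∈ (h_j, 4W log 2)` and `τ' > 4W log 2` give an explicit 2-adic irrationality measure of `ξ`:
`‖ξ − u/v‖₂ ≥ C · max(|u|,v)^{−κ}` for all rationals `u/v`, with `κ < τ'/(τ − h_j) + 1`. -/
theorem ray_measure_two_nodes (hT : TwoAdicTransfer) {j : ℕ} (hj : 1 ≤ j) (hI : RayIntegrality j)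
    {τ τ' : ℝ} (hτ1 : rayRate j < τ) (hτ2 : τ < 4 * (2 * j + 1) * log 2) (hτ' : 4 * (2 * j + 1) * log 2 < τ') :
    ∃ C : ℝ, 0 < C ∧ ∃ κ : ℝ, κ < τ' / (τ - rayRate j) + 1 ∧ ∀ r : ℚ,
      C * (max (r.num.natAbs : ℝ) r.den) ^ (-κ) ≤ ‖xi - ((r : ℚ) : ℚ_[2])‖ := by
  set ε : ℝ := (4 * (2 * j + 1) * log 2 - τ) / 2 with hε
  have hε0 : 0 < ε := by rw [hε]; linarith
  obtain ⟨n₀, hQ, hΛ⟩ := ray_growth j hj hε0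
  have hq0 : 0 ≤ rayRate j + ε := by have := rayRate_nonneg j; linarith
  have h1 : rayRate j + ε < τ + ε := by linarith
  have h2 : τ + ε < 4 * (2 * j + 1) * log 2 := by rw [hε]; linarith
  obtain ⟨C, hC, κ, hκ, h⟩ := ray_measure_explicit hT hj hI hQ hΛ hq0 h1 h2 hτ'
  refine ⟨C, hC, κ, ?_, h⟩
  have h3 : τ + ε - (rayRate j + ε) = τ - rayRate j := by ring
  rwa [h3] at hκ

/-- `b_j ≤ log (j+1) + 1` (from `log (1 + 1/j) ≤ 1/j`). -/
theorem bRate_le (j : ℕ) (hj : 1 ≤ j) : bRate j ≤ log ((j : ℝ) + 1) + 1 := by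
  unfold bRate
  have hj0 : (0 : ℝ) < j := by exact_mod_cast hj
  have hq : log (((j : ℝ) + 1) / j) ≤ ((j : ℝ) + 1) / j - 1 := Real.log_le_sub_one_of_pos (by positivity)
  rw [Real.log_div (by linarith) hj0.ne'] at hq
  have hq' : (j : ℝ) * (log ((j : ℝ) + 1) - log j) ≤ (j : ℝ) * (((j : ℝ) + 1) / j - 1) :=
    mul_le_mul_of_nonneg_left hq hj0.le
  have hid : (j : ℝ) * (((j : ℝ) + 1) / j - 1) = 1 := by field_simp; ring
  linarith

/-- **The margin is positive on every ray `j ≥ 3`**: `h_j < 4W log 2`. (Numerically `j = 2` also has a margin, `+0.02`,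
too thin for this elementary estimate; `j = 1` has none.) -/
theorem rayRate_lt (j : ℕ) (hj : 3 ≤ j) : rayRate j < 4 * (2 * j + 1) * log 2 := by
  have hj3 : (3 : ℝ) ≤ j := by exact_mod_cast hj
  have hb := bRate_le j (by omega)
  have hl2 : (0.6931471803 : ℝ) < log 2 := Real.log_two_gt_d9
  -- log (j+1) = 2 log 2 + log ((j+1)/4) ≤ 2 log 2 + (j+1)/4 − 1
  have h4 : log ((j : ℝ) + 1) ≤ 2 * log 2 + (((j : ℝ) + 1) / 4 - 1) := by
    have hq : log (((j : ℝ) + 1) / 4) ≤ ((j : ℝ) + 1) / 4 - 1 := Real.log_le_sub_one_of_pos (by positivity)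
    rw [Real.log_div (by positivity) (by norm_num), show (4 : ℝ) = 2 ^ 2 by norm_num, Real.log_pow] at hq
    push_cast at hq
    linarith
  unfold rayRate
  nlinarith

/-- **`ξ ∉ ℚ` from two named hypotheses** (every ray `j ≥ 3`): the transfer law and `P`-integrality imply that
`ξ` is not a rational number — a conditional 2-adic re-derivation, through the Catalan box family, of the KNOWN
irrationality of `ζ₂(2)` (Calegari 2005); `RayIntegrality j` is meant for `j ≥ 4` (see its docstring). -/
theorem xi_not_ratCast_two_nodes (hT : TwoAdicTransfer) {j : ℕ} (hj : 3 ≤ j) (hI : RayIntegrality j) :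
    ∀ r : ℚ, xi ≠ ((r : ℚ) : ℚ_[2]) := by
  have hlt := rayRate_lt j hj
  set ε : ℝ := (4 * (2 * j + 1) * log 2 - rayRate j) / 4 with hε
  have hε0 : 0 < ε := by rw [hε]; linarith
  obtain ⟨n₀, hQ, hΛ⟩ := ray_growth j (by omega) hε0
  obtain ⟨n₁, hG⟩ := rayGrowth_of_explicit_growth hQ hΛ hε0
  have hg0 : 0 ≤ rayRate j + ε + ε := by have := rayRate_nonneg j; linarith
  have hg1 : rayRate j + ε + ε < 4 * (2 * j + 1) * log 2 := by rw [hε]; linarith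
  exact xi_not_ratCast_of_ray hT (by omega) hI hG hg0 hg1

/-! ### The intrinsic chain (no real period, no transfer law) with the growth of `Q` discharged -/

/-- **INTRINSIC RAY MEASURE, two inputs and a size bound.**  For ANY rational sequence `P n` with, for `n ≥ 1`, the
2-ADIC identity `J2(n, jn, n, (j+1)n, n) = P n + ξ·Q_n` in `ℚ₂` and `Λ_n·P n ∈ ℤ`, and with `|Λ_n P n| ≤ e^{(h_j+ε)n}`
eventually for every `ε > 0`: every `τ ∈ (h_j, 4W log 2)`, `τ' > 4W log 2` give `‖ξ − u/v‖₂ ≥ C·max(|u|,v)^{−κ}`,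
`κ < τ'/(τ − h_j) + 1`.  Intended instance: `P n = rayPClosed j n` (fam-denom), whose three inputs are a finite
partial-fraction identity summed in `ℚ₂`, `rayPClosed_isInt`, and an elementary estimate — no `Jsym`, no `G`. -/
theorem ray_measure_intrinsic_two_inputs {j : ℕ} (hj : 1 ≤ j) (P : ℕ → ℚ)
    (hA2 : ∀ n : ℕ, 1 ≤ n →
      J2 n (j * n) n ((j + 1) * n) n = ((P n : ℚ) : ℚ_[2]) + xi * ((rayQ j n : ℚ) : ℚ_[2]))
    (hIP : ∀ n : ℕ, 1 ≤ n → ∃ z : ℤ, (z : ℚ) = rayMult j n * P n)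
    (hGP : ∀ ε : ℝ, 0 < ε → ∃ n₀ : ℕ, ∀ n : ℕ, n₀ ≤ n →
      |((rayMult j n * P n : ℚ) : ℝ)| ≤ exp ((rayRate j + ε) * n))
    {τ τ' : ℝ} (hτ1 : rayRate j < τ) (hτ2 : τ < 4 * (2 * j + 1) * log 2) (hτ' : 4 * (2 * j + 1) * log 2 < τ') :
    ∃ C : ℝ, 0 < C ∧ ∃ κ : ℝ, κ < τ' / (τ - rayRate j) + 1 ∧ ∀ r : ℚ,
      C * (max (r.num.natAbs : ℝ) r.den) ^ (-κ) ≤ ‖xi - ((r : ℚ) : ℚ_[2])‖ := by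
  set ε : ℝ := (4 * (2 * j + 1) * log 2 - τ) / 2 with hε
  have hε0 : 0 < ε := by rw [hε]; linarith
  obtain ⟨n₀, hQ, -⟩ := ray_growth j hj (half_pos hε0)
  obtain ⟨m₀, hP⟩ := hGP (ε / 2) (half_pos hε0)
  -- 2 ≤ e^{(ε/2) n} as soon as (ε/2) n ≥ 1
  obtain ⟨N, hN⟩ := exists_nat_ge (2 / ε)
  have hq0 : 0 ≤ rayRate j + ε := by have := rayRate_nonneg j; linarith
  have h1 : rayRate j + ε < τ + ε := by linarith
  have h2 : τ + ε < 4 * (2 * j + 1) * log 2 := by rw [hε]; linarith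
  have hGsum : ∀ n : ℕ, max (max n₀ m₀) N ≤ n →
      ((|rayMult j n * rayQ j n| + |rayMult j n * P n| : ℚ) : ℝ) ≤ exp ((rayRate j + ε) * n) := by
    intro n hn
    have hn1 : n₀ ≤ n := le_trans (le_trans (le_max_left _ _) (le_max_left _ _)) hn
    have hn2 : m₀ ≤ n := le_trans (le_trans (le_max_right _ _) (le_max_left _ _)) hn
    have hn3 : (2 / ε : ℝ) ≤ n := hN.trans (by exact_mod_cast le_trans (le_max_right _ _) hn)
    have hQn := hQ n hn1
    have hPn := hP n hn2
    have htwo : (2 : ℝ) ≤ exp (ε / 2 * n) := by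
      have h := Real.add_one_le_exp (ε / 2 * n)
      have : (1 : ℝ) ≤ ε / 2 * n := by
        have := (div_le_iff₀ hε0).mp hn3
        linarith
      linarith
    have hsplit : exp ((rayRate j + ε) * n) = exp ((rayRate j + ε / 2) * n) * exp (ε / 2 * n) := by
      rw [← Real.exp_add]; ring_nf
    push_cast at hQn hPn ⊢
    rw [hsplit]
    calc |(rayMult j n : ℝ) * (rayQ j n : ℝ)| + |(rayMult j n : ℝ) * (P n : ℝ)|
        ≤ exp ((rayRate j + ε / 2) * n) + exp ((rayRate j + ε / 2) * n) := add_le_add hQn hPn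
      _ = exp ((rayRate j + ε / 2) * n) * 2 := by ring
      _ ≤ exp ((rayRate j + ε / 2) * n) * exp (ε / 2 * n) := by gcongr
  obtain ⟨n₁, hmeas⟩ := ray_measure_intrinsic hj P hA2 hIP hGsum hq0 h1 h2 hτ'
  refine ⟨exp (-(τ' * (n₁ + 1))), exp_pos _, τ' / (τ - rayRate j), lt_add_one _, fun r => ?_⟩
  have h3 : τ + ε - (rayRate j + ε) = τ - rayRate j := by ring
  have := hmeas r
  rwa [h3] at this

/-- **`ξ ∉ ℚ`, intrinsic form** (every ray `j ≥ 3`): the 2-adic identity for some integral-after-clearing rational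
sequence `P n` of sub-`e^{(h_j+ε)n}` growth already forces `ξ ∉ ℚ` — no real period, no transfer law. -/
theorem xi_not_ratCast_intrinsic {j : ℕ} (hj : 3 ≤ j) (P : ℕ → ℚ)
    (hA2 : ∀ n : ℕ, 1 ≤ n →
      J2 n (j * n) n ((j + 1) * n) n = ((P n : ℚ) : ℚ_[2]) + xi * ((rayQ j n : ℚ) : ℚ_[2]))
    (hIP : ∀ n : ℕ, 1 ≤ n → ∃ z : ℤ, (z : ℚ) = rayMult j n * P n)
    (hGP : ∀ ε : ℝ, 0 < ε → ∃ n₀ : ℕ, ∀ n : ℕ, n₀ ≤ n →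
      |((rayMult j n * P n : ℚ) : ℝ)| ≤ exp ((rayRate j + ε) * n)) :
    ∀ r : ℚ, xi ≠ ((r : ℚ) : ℚ_[2]) := by
  intro r hr
  obtain ⟨τ, hτ1, hτ2⟩ := exists_between (rayRate_lt j hj)
  obtain ⟨C, hC, κ, -, hmeas⟩ :=
    ray_measure_intrinsic_two_inputs (by omega) P hA2 hIP hGP hτ1 hτ2 (lt_add_one _)
  have h := hmeas r
  rw [hr, sub_self, norm_zero] at h
  have hH : (0 : ℝ) < max (r.num.natAbs : ℝ) r.den :=
    lt_of_lt_of_le (by exact_mod_cast r.den_pos) (le_max_right _ _)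
  have hpos : (0 : ℝ) < C * (max (r.num.natAbs : ℝ) r.den) ^ (-κ) := by positivity
  linarith

end Summit.KontsevichZagierPeriods.Zeta5Search.CatalanTwoAdicSeries
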